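import Summits.ValiantsHypothesis.ValiantsHypothesis.Theses.HartogsRankTwo

/-!
# ValiantsHypothesis / HartogsRankTwo — item `RectangleCriterion` (stmt-ValiantsHypothesis-10333), closed

A generalized matrix function `d_q = Σ_σ q(σ) Π_i x_{σ(i),i}` vanishes on all rank-`≤ 2` points
`x_{ri} = U_{r0}V_{i0} + U_{r1}V_{i1}` iff every rectangle sum `Σ_{σ : σ(A) = B} q(σ)` vanishes.
(⇐) expand `Π_i (U_{σ i,0}V_{i0} + U_{σ i,1}V_{i1}) = Σ_S Π_{i∈S} U_{σ i,0}V_{i0} Π_{i∉S} U_{σ i,1}V_{i1}`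
and group the permutations by `B = σ(S)`: the `U,V`-weight depends only on `(S, B)`.
(⇒) test at the 0/1 points `U_{r0} = [r ∈ B]`, `U_{r1} = [r ∉ B]`, `V_{i0} = [i ∈ A]`, `V_{i1} = [i ∉ A]`,
where `x_{σ(i),i} = [σ i ∈ B ↔ i ∈ A]` and `d_q(UVᵀ)` is exactly the rectangle sum for `(A, B)`.
HONEST FRAMING: bookkeeping (an elementary dictionary); nothing here is progress on `VP ≠ VNP`.
-/

-- layout Summits/ValiantsHypothesis/ValiantsHypothesis forces the duplicated namespace component
set_option linter.dupNamespace false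

namespace Summit.ValiantsHypothesis.ValiantsHypothesis.Theorems.HartogsRankTwo

open MvPolynomial

/-- Evaluation of a generalized matrix function at a point. [folklore] -/
private theorem eval_gmf {n : ℕ} (q : Equiv.Perm (Fin n) → ℂ) (pt : Fin n × Fin n → ℂ) :
    eval pt (∑ σ : Equiv.Perm (Fin n), C (q σ) * ∏ i : Fin n, X (σ i, i)) =
      ∑ σ : Equiv.Perm (Fin n), q σ * ∏ i, pt (σ i, i) := by
  simp only [map_sum, map_mul, eval_C, map_prod, eval_X]

/-- `σ(A) = B` iff `σ i ∈ B ↔ i ∈ A` for all `i`. [folklore] -/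
private theorem map_eq_iff {n : ℕ} (σ : Equiv.Perm (Fin n)) (A B : Finset (Fin n)) :
    A.map σ.toEmbedding = B ↔ ∀ i, σ i ∈ B ↔ i ∈ A := by
  constructor
  · rintro rfl i
    exact Finset.mem_map' σ.toEmbedding
  · intro h
    ext r
    rw [Finset.mem_map_equiv, ← h (σ.symm r), Equiv.apply_symm_apply]

/-- Images of complements under a permutation. [folklore] -/
private theorem map_univ_sdiff {n : ℕ} (σ : Equiv.Perm (Fin n)) (S : Finset (Fin n)) :
    (Finset.univ \ S).map σ.toEmbedding = Finset.univ \ S.map σ.toEmbedding := by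
  ext r
  simp only [Finset.mem_map_equiv, Finset.mem_sdiff, Finset.mem_univ, true_and]

/-- **Item `RectangleCriterion` (stmt-ValiantsHypothesis-10333).** [folklore] -/
theorem rectangleCriterion_proof : Theses.HartogsRankTwo.RectangleCriterion := by
  unfold Theses.HartogsRankTwo.RectangleCriterion
  intro n q
  constructor
  · -- (⇒): test at 0/1 points
    intro h A B _
    let U : Fin n → Fin 2 → ℂ := fun r t => if t = 0 then (if r ∈ B then 1 else 0) else (if r ∈ B then 0 else 1)
    let V : Fin n → Fin 2 → ℂ := fun i t => if t = 0 then (if i ∈ A then 1 else 0) else (if i ∈ A then 0 else 1)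
    have hUV := h U V
    rw [eval_gmf] at hUV
    have hpt : ∀ r i : Fin n, (∑ t : Fin 2, U r t * V i t) = if (r ∈ B ↔ i ∈ A) then 1 else 0 := by
      intro r i
      rw [Fin.sum_univ_two]
      by_cases hr : r ∈ B <;> by_cases hi : i ∈ A <;> simp [U, V, hr, hi]
    simp_rw [hpt, Finset.prod_boole] at hUV
    simp only [Finset.mem_univ, true_implies] at hUV
    simp_rw [← map_eq_iff, mul_boole] at hUV
    rw [← Finset.sum_filter] at hUV
    exact hUV
  · -- (⇐): expand and group by `B = σ(S)`
    intro h U V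
    rw [eval_gmf]
    simp_rw [Fin.sum_univ_two, Finset.prod_add, Finset.mul_sum]
    rw [Finset.sum_comm]
    refine Finset.sum_eq_zero (fun S _ => ?_)
    -- the `U`-weight of `σ` depends only on `σ(S)`
    have hw : ∀ σ : Equiv.Perm (Fin n),
        q σ * ((∏ i ∈ S, U (σ i) 0 * V i 0) * ∏ i ∈ Finset.univ \ S, U (σ i) 1 * V i 1) =
        ((∏ i ∈ S, V i 0) * ∏ i ∈ Finset.univ \ S, V i 1) *
          (q σ * ((∏ r ∈ S.map σ.toEmbedding, U r 0) * ∏ r ∈ Finset.univ \ S.map σ.toEmbedding, U r 1)) := by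
      intro σ
      rw [Finset.prod_mul_distrib, Finset.prod_mul_distrib, ← map_univ_sdiff, Finset.prod_map,
        Finset.prod_map]
      simp only [Equiv.coe_toEmbedding]
      ring
    simp_rw [hw, ← Finset.mul_sum]
    refine mul_eq_zero_of_right _ ?_
    rw [← Finset.sum_fiberwise_of_maps_to (s := Finset.univ) (t := (Finset.univ : Finset (Finset (Fin n))))
      (g := fun σ : Equiv.Perm (Fin n) => S.map σ.toEmbedding) (fun _ _ => Finset.mem_univ _)]
    refine Finset.sum_eq_zero (fun B _ => ?_)
    have hin : ∀ σ ∈ Finset.univ.filter (fun σ : Equiv.Perm (Fin n) => S.map σ.toEmbedding = B),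
        q σ * ((∏ r ∈ S.map σ.toEmbedding, U r 0) * ∏ r ∈ Finset.univ \ S.map σ.toEmbedding, U r 1) =
        q σ * ((∏ r ∈ B, U r 0) * ∏ r ∈ Finset.univ \ B, U r 1) := by
      intro σ hσ
      rw [Finset.mem_filter] at hσ
      rw [hσ.2]
    rw [Finset.sum_congr rfl hin, ← Finset.sum_mul]
    refine mul_eq_zero_of_left ?_ _
    by_cases hcard : S.card = B.card
    · exact h S B hcard
    · refine Finset.sum_eq_zero (fun σ hσ => ?_)
      rw [Finset.mem_filter] at hσ
      exact absurd (by rw [← hσ.2, Finset.card_map]) hcard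

end Summit.ValiantsHypothesis.ValiantsHypothesis.Theorems.HartogsRankTwo
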